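/-
Origin: written from primary sources — A. Borel, *Automorphic forms on SL₂(ℝ)* (1997) §5.14 (the canonical automorphy factor and the
cotangent cocycle); S. Helgason, *Differential Geometry, Lie Groups, and Symmetric Spaces* (1978) Ch. VIII §7 (the isotropy representation
on the holomorphic tangent space). Adapted: no. Elementary linear algebra on the tree's `BallForms.cotangentCocycle` and
`BallModel.isotropyDetChar`: the DUAL of the cotangent weight of the isotropy group `K = Stab(x₀)` is the tangent (isotropy) representation,
its matrix in the coordinate basis is the Jacobian `D(k)(x₀)` and its determinant is the `∧²𝔭₊` character. Kernel only; no records.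
-/
import Literature.AlgebraicGeometry.ShimuraVarieties.UnitaryBallAutomorphicForms
import Literature.Geometry.ComplexHyperbolic.UnitBallIsotropyCharacter
import HarnessLib

/-!
# The dual of the cotangent weight of `K = Stab(x₀)`: matrix `D(k)(x₀)` and determinant `∧²𝔭₊`

For the unit ball `𝔹² = U(2,1)/K`, the weight of holomorphic one-forms is the cotangent weight
`τ₁ := isPullbackCocycle_cotangentCocycle.weightOf x₀ : K →* End(ℂ²)`, `τ₁ k = (D(k⁻¹)(x₀))ᵀ` (`AutomorphyFactorForms.weightOf`,
`BallForms.cotangentCocycle`).  Its DUAL representation on `(ℂ²)^∨` — the `K`-type `𝔭₊` of the test vectors in a `K`-type situation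
(`KTypeSituation.ι : W^∨ → E`, `hι : ι (τ^∨ k ℓ) = σ k (ι ℓ)`) — acts on the coordinate functionals `proj i` through the Jacobian at the
base point (the sibling `UnitaryBallCotangentWeight` gives the same dual in dot-product coordinates as `𝔭₊ = pPlus` on `U(2) × U(1)`;
here the MATRIX form on the basis `proj` with its determinant, the shape the see-saw wedge lemmas consume):

* **`weightOf_dual_proj`** — `τ₁^∨ k (proj i) = Σ_j D(k)(x₀)_{j i} • proj j` [Borel1997, §5.14];
* **`map_weightOf_dual_proj`** — the same after any linear map `J : (ℂ²)^∨ → E` (the shape `A (a i) = Σ_j m j i • a j` of the tree's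
  `WedgePairDeterminant` / `UnitaryDualPairSeesawWedgeCMKType`, with `m = D(k)(x₀)`);
* **`det_Jac_x₀_eq_isotropyDetChar`** — `det D(k)(x₀) = isotropyDetChar k` (`∧²𝔭₊`, [Helgason1978, VIII §7]).

Provenance / use (Hodge–CM model-construction cell, E binder `gen12`, junction (SS-K), PKG `Model/Binders/Gen12WedgeKType.wedgeMem_of_kType`):
with theta-3's strictness exports (E3)/(E4) the test pairs of the two lines transform along the archimedean isotropy through `τ₁^∨`, i.e.
through the matrices `m k := D(π k)(x₀)`, and `det (m k) = archKappa k` (`UnitaryGroupArchIsotropy.coe_archKappa`) is the hypothesis `hdet`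
there.  Nothing here is a claim of the manuscripts under adjudication.
-/

set_option autoImplicit false

noncomputable section

open Matrix MulAction
open Literature.Geometry.ComplexHyperbolic
open Literature.Geometry.ComplexHyperbolic.BallModel (U21 Ball Jac x₀ isotropyDetChar)
open Literature.NumberTheory.Automorphic.AutomorphyFactor

namespace Literature.AlgebraicGeometry.ShimuraVarieties

namespace BallForms

/-- The cotangent weight at an isotropy element: `τ₁ k v = (D(k⁻¹)(x₀))ᵀ v`. [cite: Borel1997, §5.14] -/
theorem weightOf_cotangent_apply_transpose_Jac (k : stabilizer U21 x₀) (v : Fin 2 → ℂ) :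
    isPullbackCocycle_cotangentCocycle.weightOf x₀ k v = (Jac ((k : U21)⁻¹) x₀)ᵀ *ᵥ v := by
  rw [IsPullbackCocycle.weightOf_apply, cotangentCocycle_apply]

/-- **The dual of the cotangent weight acts on the coordinate functionals through the Jacobian at the base point**:
`τ₁^∨ k (proj i) = Σ_j D(k)(x₀)_{j i} • proj j`. [cite: Borel1997, §5.14] -/
theorem weightOf_dual_proj (k : stabilizer U21 x₀) (i : Fin 2) :
    (isPullbackCocycle_cotangentCocycle.weightOf x₀).dual k (LinearMap.proj i) =
      ∑ j, (Jac (k : U21) x₀) j i • (LinearMap.proj j : Module.Dual ℂ (Fin 2 → ℂ)) := by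
  apply LinearMap.ext
  intro v
  rw [Representation.dual_apply, Module.Dual.transpose_apply, LinearMap.comp_apply, weightOf_cotangent_apply_transpose_Jac]
  simp only [Subgroup.coe_inv, inv_inv, LinearMap.coe_proj, Function.eval, LinearMap.coe_sum, Finset.sum_apply,
    LinearMap.smul_apply, smul_eq_mul, Matrix.mulVec, dotProduct, Matrix.transpose_apply]

/-- The same after any linear map `J : (ℂ²)^∨ → E`: `J (τ₁^∨ k (proj i)) = Σ_j D(k)(x₀)_{j i} • J (proj j)` — the matrix shape
`A (a i) = Σ_j m j i • a j` with `m = D(k)(x₀)`. [cite: Borel1997, §5.14] -/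
theorem map_weightOf_dual_proj {E : Type*} [AddCommGroup E] [Module ℂ E] (J : Module.Dual ℂ (Fin 2 → ℂ) →ₗ[ℂ] E)
    (k : stabilizer U21 x₀) (i : Fin 2) :
    J ((isPullbackCocycle_cotangentCocycle.weightOf x₀).dual k (LinearMap.proj i)) =
      ∑ j, (Jac (k : U21) x₀) j i • J (LinearMap.proj j) := by
  rw [weightOf_dual_proj, map_sum]
  simp only [map_smul]

/-- **`det D(k)(x₀) = ∧²𝔭₊(k)`**: the determinant of the matrix of `τ₁^∨ k` is the isotropy character `isotropyDetChar`.
[cite: Helgason1978, Ch. VIII §7] -/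
theorem det_Jac_x₀_eq_isotropyDetChar (k : stabilizer U21 x₀) :
    (Jac (k : U21) x₀).det = (isotropyDetChar k : ℂ) :=
  (BallModel.coe_isotropyDetChar k).symm

end BallForms

end Literature.AlgebraicGeometry.ShimuraVarieties

end
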